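import Mathlib
import Literature.MathematicalPhysics.QuantumLattice.EuclideanAction
import Literature.Analysis.FluidPDE.OctahedralSymmetry
import Literature.Analysis.Matrix.SchoenbergKernelsProofs
import Summits.QuantumFields.YangMills.Theses.PencilRigidity
import HarnessLib

/-!
# Pencil rigidity — the four axis mirrors alone do not force `O(4)`-invariance

Item stmt-QuantumFields-11690 (`AxisMirrorsInsufficient`, support, negative-side calibration Z1 of
route `PencilRigidity`, sub-problem YangMills): there is a continuous bounded real kernel on `ℝ⁴`,
invariant under the hyperoctahedral group `W(B₄)` (all signed permutations of the coordinates) and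
pointwise Osterwalder–Schrader positive across the time-zero hyperplane `x₀ = 0`, which is NOT
invariant under all linear isometries off the origin. It records that the diagonal-mirror
hypothesis of the crux `ShellRigidity` is load-bearing.

## The witness and the proof

`K(x) = exp(−Σ_μ |x_μ|)` (written out everywhere; the file declares no definitions).
* continuity and the bound `|K| ≤ 1` are immediate;
* `W(B₄)`-invariance: by the classification of signed-permutation isometries
  (`Literature.Analysis.FluidPDE.IsSignedPermIsometry.exists_eq_signedPermIsometry`) such an `R`
  acts by `(R x)_j = ± x_{σ j}`, and `Σ_j |± x_{σ j}| = Σ_μ |x_μ|`;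
* OS-positivity across `x₀ = 0`: for `xᵢ⁰ > 0`,
  `K(θxᵢ − xⱼ) = e^{−xᵢ⁰} e^{−xⱼ⁰} · Π_{μ=1,2,3} e^{−|xᵢ^μ − xⱼ^μ|}`, a rank-one kernel times three
  pull-backs of the Ornstein–Uhlenbeck kernel `e^{−|s−t|}` on `ℝ`, which is positive definite
  because `e^{−|s−t|} = e^{−s} e^{−t} · λ((0, e^{2s}) ∩ (0, e^{2t}))` (rank one times a Gram kernel of
  indicator functions, Mathlib `MeasureTheory.posSemidef_matrix_measure_inter`); products of
  positive definite kernels are positive definite (Schur, `Literature.Analysis.Matrix.IsPosDefKernel.mul`);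
* non-invariance: the reflection in the hyperplane orthogonal to `e₀ − w`, `w = (½,½,½,½)`, is a
  linear isometry mapping `e₀ ↦ w` (Mathlib `Submodule.reflection_sub`), while
  `K(e₀) = e⁻¹ ≠ e⁻² = K(w)`.

Sources: the item text of route `PencilRigidity` (card e1-counterexample-zoo, Z1); positive
definiteness of `e^{−|t|}` and the Schur product theorem are Berg–Christensen–Ressel, *Harmonic
Analysis on Semigroups* (1984), Ch. 3 (here through `Literature/Analysis/Matrix/SchoenbergKernels*`).
-/

noncomputable section

namespace Summit.QuantumFields.YangMills.Theorems

namespace AxisMirrorsInsufficient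

open MeasureTheory
open Literature.MathematicalPhysics.QuantumLattice (timeReflection timeReflection_apply)
open Literature.Analysis.FluidPDE (IsSignedPermIsometry signedPermIsometry signedPermIsometry_apply)
open Literature.Analysis.Matrix (IsPosDefKernel isPosDefKernel_iff isPosDefKernel_mul_fun
  sum_mul_mul_nonneg_of_posSemidef)

/-! Throughout, the witness is the kernel `K(x) = exp(−Σ_μ |x_μ|)` on `ℝ⁴`, always written out
(no auxiliary definition, so that this file is a pure proof of the route decl). -/

/-- `K(x) = exp(−Σ_μ |x_μ|)` is continuous. -/
theorem continuous_kernel :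
    Continuous fun x : EuclideanSpace ℝ (Fin 4) => Real.exp (-∑ μ, |x μ|) := by
  fun_prop

/-- `|K x| ≤ 1` for `K(x) = exp(−Σ_μ |x_μ|)`. -/
theorem abs_kernel_le_one (x : EuclideanSpace ℝ (Fin 4)) : |Real.exp (-∑ μ, |x μ|)| ≤ 1 := by
  rw [abs_of_pos (Real.exp_pos _), Real.exp_le_one_iff, neg_nonpos]
  exact Finset.sum_nonneg fun μ _ => abs_nonneg _

/-- `K(x) = exp(−Σ_μ |x_μ|)` is invariant under every signed permutation of the coordinates (the
hyperoctahedral group `W(B₄)`): `(R x)_j = ± x_{σ j}` by the classification of signed-permutation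
isometries, and `Σ_j |x_{σ j}| = Σ_μ |x_μ|`. -/
theorem kernel_signedPerm (R : EuclideanSpace ℝ (Fin 4) ≃ₗᵢ[ℝ] EuclideanSpace ℝ (Fin 4))
    (hR : IsSignedPermIsometry R) (x : EuclideanSpace ℝ (Fin 4)) :
    Real.exp (-∑ μ, |R x μ|) = Real.exp (-∑ μ, |x μ|) := by
  obtain ⟨σ, s, rfl⟩ := hR.exists_eq_signedPermIsometry
  congr 2
  calc ∑ μ, |signedPermIsometry σ s x μ| = ∑ μ, |x (σ μ)| := by
        refine Finset.sum_congr rfl fun μ _ => ?_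
        rw [signedPermIsometry_apply, abs_mul]
        rcases Int.units_eq_one_or (s μ) with h | h <;> simp [h]
    _ = ∑ μ, |x μ| := Equiv.sum_comp σ (fun μ => |x μ|)

/-- Pull-back of a positive definite kernel along any map is positive definite. -/
theorem isPosDefKernel_comp {X Y : Type*} {φ : X → X → ℝ} (h : IsPosDefKernel φ) (f : Y → X) :
    IsPosDefKernel fun y y' => φ (f y) (f y') :=
  ⟨fun y y' => h.1 (f y) (f y'), fun n x c => h.2 n (f ∘ x) c⟩

/-- The Gram kernel `(s, t) ↦ λ((0, e^{2s}) ∩ (0, e^{2t})) = e^{2 min(s,t)}` of the indicator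
functions `1_{(0, e^{2s})} ∈ L²(ℝ)` is positive definite
(Mathlib `MeasureTheory.posSemidef_matrix_measure_inter`). -/
theorem isPosDefKernel_volume_inter :
    IsPosDefKernel fun s t : ℝ =>
      (volume.real (Set.Ioo (0 : ℝ) (Real.exp (2 * s)) ∩ Set.Ioo 0 (Real.exp (2 * t)))) := by
  refine ⟨fun s t => by dsimp only; rw [Set.inter_comm], fun n x c => ?_⟩
  have hM := MeasureTheory.posSemidef_matrix_measure_inter (μ := (volume : Measure ℝ))
    (s := fun i : Fin n => Set.Ioo (0 : ℝ) (Real.exp (2 * x i)))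
    (fun _ => measurableSet_Ioo) (fun _ => measure_Ioo_lt_top.ne)
  exact sum_mul_mul_nonneg_of_posSemidef hM c

/-- The pointwise identity `e^{−s} e^{−t} · λ((0, e^{2s}) ∩ (0, e^{2t})) = e^{−|s − t|}`. -/
theorem exp_neg_mul_exp_neg_mul_volume_inter (s t : ℝ) :
    Real.exp (-s) * Real.exp (-t) *
        volume.real (Set.Ioo (0 : ℝ) (Real.exp (2 * s)) ∩ Set.Ioo 0 (Real.exp (2 * t))) =
      Real.exp (-|s - t|) := by
  rw [Set.Ioo_inter_Ioo, max_self]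
  wlog hst : s ≤ t generalizing s t
  · rw [min_comm, mul_comm (Real.exp (-s)), abs_sub_comm]
    exact this t s (le_of_not_ge hst)
  rw [min_eq_left (Real.exp_le_exp.2 (by linarith)), Real.volume_real_Ioo_of_le (Real.exp_pos _).le,
    sub_zero, abs_of_nonpos (by linarith), ← Real.exp_add, ← Real.exp_add]
  congr 1
  ring

/-- **The Ornstein–Uhlenbeck kernel is positive definite**: `Σ_{j,k} c_j c_k e^{−|s_j − s_k|} ≥ 0`
for all real `s₁, …, s_n` and `c` — the product of the rank-one kernel `e^{−s} e^{−t}` and the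
Gram kernel `λ((0, e^{2s}) ∩ (0, e^{2t}))` (Berg–Christensen–Ressel 1984, Ch. 3, 1.9–1.12). -/
theorem isPosDefKernel_exp_neg_abs_sub :
    IsPosDefKernel fun s t : ℝ => Real.exp (-|s - t|) := by
  have h := (isPosDefKernel_mul_fun fun s : ℝ => Real.exp (-s)).mul isPosDefKernel_volume_inter
  refine ⟨fun s t => by dsimp only; rw [abs_sub_comm], fun n x c => ?_⟩
  refine (h.2 n x c).trans_eq (Finset.sum_congr rfl fun j _ => Finset.sum_congr rfl fun k _ => ?_)
  dsimp only
  rw [exp_neg_mul_exp_neg_mul_volume_inter]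

/-- The factorised kernel `e^{−x⁰} e^{−y⁰} Π_{μ=1,2,3} e^{−|x^μ − y^μ|}` on `ℝ⁴` is positive definite
(rank one times three pull-backs of the Ornstein–Uhlenbeck kernel; Schur products). -/
theorem isPosDefKernel_factorised :
    IsPosDefKernel fun x y : EuclideanSpace ℝ (Fin 4) =>
      Real.exp (-x 0) * Real.exp (-y 0) * Real.exp (-|x 1 - y 1|) * Real.exp (-|x 2 - y 2|) *
        Real.exp (-|x 3 - y 3|) :=
  (((isPosDefKernel_mul_fun fun x : EuclideanSpace ℝ (Fin 4) => Real.exp (-x 0)).mul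
    (isPosDefKernel_comp isPosDefKernel_exp_neg_abs_sub fun x : EuclideanSpace ℝ (Fin 4) => x 1)).mul
    (isPosDefKernel_comp isPosDefKernel_exp_neg_abs_sub fun x : EuclideanSpace ℝ (Fin 4) => x 2)).mul
    (isPosDefKernel_comp isPosDefKernel_exp_neg_abs_sub fun x : EuclideanSpace ℝ (Fin 4) => x 3)

/-- On points with positive time coordinates the reflected kernel `K(x) = exp(−Σ_μ |x_μ|)`
factorises: `K(θx − y) = e^{−x⁰} e^{−y⁰} Π_{μ=1,2,3} e^{−|x^μ − y^μ|}`. -/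
theorem kernel_timeReflection_sub {x y : EuclideanSpace ℝ (Fin 4)} (hx : 0 < x 0) (hy : 0 < y 0) :
    Real.exp (-∑ μ, |(timeReflection 4 x - y) μ|) =
      Real.exp (-x 0) * Real.exp (-y 0) * Real.exp (-|x 1 - y 1|) * Real.exp (-|x 2 - y 2|) *
        Real.exp (-|x 3 - y 3|) := by
  have h0 : |-x 0 - y 0| = x 0 + y 0 := by
    rw [abs_of_nonpos (by linarith)]
    ring
  simp only [Fin.sum_univ_four, PiLp.sub_apply, timeReflection_apply, Fin.isValue, if_true,
    ← Real.exp_add]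
  congr 1
  have h1 : ((1 : Fin 4) = 0) = False := by decide
  have h2 : ((2 : Fin 4) = 0) = False := by decide
  have h3 : ((3 : Fin 4) = 0) = False := by decide
  simp only [h1, h2, h3, if_false, h0]
  ring

/-- `K(x) = exp(−Σ_μ |x_μ|)` is pointwise OS-positive across the hyperplane `x₀ = 0`. -/
theorem kernel_osPositive (m : ℕ) (x : Fin m → EuclideanSpace ℝ (Fin 4)) (c : Fin m → ℝ)
    (hx : ∀ i, 0 < x i 0) :
    0 ≤ ∑ i, ∑ j, c i * c j * Real.exp (-∑ μ, |(timeReflection 4 (x i) - x j) μ|) := by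
  refine (isPosDefKernel_factorised.2 m x c).trans_eq
    (Finset.sum_congr rfl fun i _ => Finset.sum_congr rfl fun j _ => ?_)
  rw [kernel_timeReflection_sub (hx i) (hx j)]

/-- The vector `w = (½, ½, ½, ½)` of `ℝ⁴` has norm `1`. -/
theorem norm_halfVec : ‖(WithLp.toLp 2 fun _ : Fin 4 => (1 / 2 : ℝ) : EuclideanSpace ℝ (Fin 4))‖ = 1 := by
  rw [EuclideanSpace.norm_eq]
  simp only [Real.norm_eq_abs, Finset.sum_const, Finset.card_univ, Fintype.card_fin]
  rw [Real.sqrt_eq_one]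
  norm_num

/-- `K(w) = e⁻²` for `w = (½, ½, ½, ½)` and `K(x) = exp(−Σ_μ |x_μ|)`. -/
theorem kernel_halfVec :
    Real.exp (-∑ μ, |(WithLp.toLp 2 fun _ : Fin 4 => (1 / 2 : ℝ) : EuclideanSpace ℝ (Fin 4)) μ|) =
      Real.exp (-2) := by
  simp only [Finset.sum_const, Finset.card_univ, Fintype.card_fin]
  norm_num

/-- `K(e₀) = e⁻¹` for `K(x) = exp(−Σ_μ |x_μ|)`. -/
theorem kernel_single_zero :
    Real.exp (-∑ μ, |(EuclideanSpace.single 0 1 : EuclideanSpace ℝ (Fin 4)) μ|) = Real.exp (-1) := by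
  simp [Fin.sum_univ_four]

/-- `K(x) = exp(−Σ_μ |x_μ|)` is not invariant under all linear isometries off the origin: the
reflection taking `e₀` to `w = (½, ½, ½, ½)` changes its value from `e⁻¹` to `e⁻²`. -/
theorem kernel_not_invariant :
    ¬ ∀ (R : EuclideanSpace ℝ (Fin 4) ≃ₗᵢ[ℝ] EuclideanSpace ℝ (Fin 4)) (x : EuclideanSpace ℝ (Fin 4)),
      x ≠ 0 → Real.exp (-∑ μ, |R x μ|) = Real.exp (-∑ μ, |x μ|) := by
  intro h
  have hnorm : ‖(EuclideanSpace.single 0 1 : EuclideanSpace ℝ (Fin 4))‖ =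
      ‖(WithLp.toLp 2 fun _ : Fin 4 => (1 / 2 : ℝ) : EuclideanSpace ℝ (Fin 4))‖ := by
    rw [norm_halfVec]
    simp
  have hv0 : (EuclideanSpace.single 0 1 : EuclideanSpace ℝ (Fin 4)) ≠ 0 := by
    simp
  have key := h (Submodule.reflection (ℝ ∙ ((EuclideanSpace.single 0 1 : EuclideanSpace ℝ (Fin 4)) -
    (WithLp.toLp 2 fun _ : Fin 4 => (1 / 2 : ℝ) : EuclideanSpace ℝ (Fin 4))))ᗮ) _ hv0
  rw [Submodule.reflection_sub hnorm, kernel_halfVec, kernel_single_zero] at key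
  have := Real.exp_injective key
  norm_num at this

end AxisMirrorsInsufficient

open AxisMirrorsInsufficient in
/-- **`AxisMirrorsInsufficient` (item stmt-QuantumFields-11690 of route `PencilRigidity`).** The
kernel `K(x) = exp(−Σ_μ |x_μ|)` on `ℝ⁴` is continuous, bounded, invariant under every signed
permutation of the coordinates and pointwise OS-positive across `x₀ = 0`, but not invariant under
all linear isometries off the origin (`K(e₀) = e⁻¹ ≠ e⁻² = K(½,½,½,½)`): reflection positivity
across the four axis mirrors does not force `O(4)`-invariance. -/
theorem axisMirrorsInsufficient_proof :
    Summit.QuantumFields.YangMills.Theses.PencilRigidity.AxisMirrorsInsufficient := by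
  unfold Summit.QuantumFields.YangMills.Theses.PencilRigidity.AxisMirrorsInsufficient
  intro E
  exact ⟨fun x => Real.exp (-∑ μ, |x μ|), continuous_kernel, ⟨1, abs_kernel_le_one⟩,
    fun R hR x => kernel_signedPerm R hR x, kernel_osPositive, kernel_not_invariant⟩

end Summit.QuantumFields.YangMills.Theorems
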